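import Summits.QuantumFields.BalabanUV.T4Continuum.Support.VariationalCovariantScalarForm

/-!
# T⁴ programme, spine node NE2 (U1a), lane P2 — THE LEVEL-0 UPPER BOUND (the base of `VariationalCovariantUpper.ub_tower`) for the charged scalar:
# at block side `n = 1` the transported-average constraint FIXES the field, so `Δ′_0(μ) ≤ Sc(conj T·μ) ≤ 4d·Σ|μ|²`
# (`t4/skeletons/NE2-t4-ne2-p2.md` v0.8 §2.C, UB⁺ row; cell `pub-balaban`, row NE2 co-owner #2, lineage t4-ne2-p2 gen 10)

HONEST FRAMING (T4-DAG p. 1).  Rung (B)+1 only — NOT infinite volume, NOT a mass gap, NOT Clay.  NE2 is NOT IN PRINT and NOT proved here.  MODEL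
LEVEL, [folklore]: with `VariationalCovariantUpper.ub_tower` (UB⁺ propagates up the tower given P⁺/ONE⁺/REG⁺) this file supplies the trivial level-0
input `hUB0` with `Λ₀ = 4d` for King's charged scalar (contractive bond phases, unit-modulus site transports).  Nothing printed is a hypothesis; no
`def … : Prop` fact; no `sorry`; axioms standard.  HONEST DEPENDENCY (cell, verbatim): continuum YM on T⁴ ⇐ BetaPertH ∧ nine spine estimates (0/9
proved); BetaPertH ⇐ (D1) ∧ (D4) ∧ CAP+tail; G-an2-4 gates asym, D1 and NE2/3/4.
-/

noncomputable section

open scoped BigOperators ComplexConjugate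

namespace Summit.QuantumFields.BalabanUV.T4Continuum.VariationalCovariantLevelZero

open Finset
open Literature.MathematicalPhysics.QuantumFieldTheory.Balaban1983to89
open Literature.MathematicalPhysics.QuantumFieldTheory.Balaban1983to89.B5Prop11Plancherel (Tor fine unitVec)
open Literature.MathematicalPhysics.QuantumFieldTheory.Balaban1983to89.B5Prop11Lower (nsq nsq_nonneg)
open Literature.MathematicalPhysics.QuantumFieldTheory.Balaban1983to89.B5Block118 (bpt)
open Literature.MathematicalPhysics.QuantumFieldTheory.Balaban1983to89.B5Blocks16 (blockOf blockOf_bpt)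
open Literature.MathematicalPhysics.QuantumFieldTheory.Balaban1983to89.B5AverageCurlStokes (sum_blocks_real)
open Summit.QuantumFields.BalabanUV.T4Continuum.VariationalCovariantFederbush (Qc dirU dirU_nonneg)
open Summit.QuantumFields.BalabanUV.T4Continuum.VariationalCovariantScalarPair (Sc Qk)
open Summit.QuantumFields.BalabanUV.T4Continuum.VariationalCovariantScalarForm (sum_dirU_le)

variable {d : ℕ} (M : Fin d → ℕ) [hM : ∀ μ, NeZero (M μ)]

/-- at block side `1` the offset type `Fin d → Fin 1` has exactly one element. [folklore] -/
theorem card_offsets_one : (Finset.univ : Finset (Fin d → Fin 1)).card = 1 := by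
  rw [Finset.card_univ, Fintype.card_fun, Fintype.card_fin, Fintype.card_fin, one_pow]

/-- the explicit level-0 field: `f(x) = conj T(x)·μ(block of x)`. [folklore] -/
def lift (T : Tor (fine 1 M) → ℂ) (μ : Tor M → ℂ) : Tor (fine 1 M) → ℂ := fun x => (starRingEnd ℂ) (T x) * μ (blockOf 1 M x)

/-- the lifted field satisfies the transported-average constraint exactly (unit-modulus transports). [folklore] -/
theorem Qk_lift (T : Tor (fine 1 M) → ℂ) (hT : ∀ x, ‖T x‖ = 1) (μ : Tor M → ℂ) : Qk 1 M T (lift M T μ) = μ := by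
  funext z
  have hTT : ∀ x, T x * (starRingEnd ℂ) (T x) = 1 := fun x => by
    rw [Complex.mul_conj, Complex.normSq_eq_norm_sq, hT, one_pow, Complex.ofReal_one]
  simp only [Qk, Qc, lift, blockOf_bpt, Nat.cast_one, one_pow, inv_one, one_mul]
  have : ∀ j : Fin d → Fin 1, T (bpt 1 M z j) * ((starRingEnd ℂ) (T (bpt 1 M z j)) * μ z) = μ z := fun j => by
    rw [← mul_assoc, hTT, one_mul]
  simp_rw [this]
  rw [sum_const, card_offsets_one, one_smul]

/-- the lifted field has the `ℓ²` mass of the unit datum. [folklore] -/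
theorem nsq_lift (T : Tor (fine 1 M) → ℂ) (hT : ∀ x, ‖T x‖ = 1) (μ : Tor M → ℂ) : nsq (lift M T μ) = nsq μ := by
  unfold nsq
  rw [sum_blocks_real 1 M (fun x => ‖lift M T μ x‖ ^ 2)]
  refine Finset.sum_congr rfl fun z _ => ?_
  simp only [lift, blockOf_bpt, norm_mul, Complex.norm_conj, hT, one_mul, sum_const, card_offsets_one, one_smul]

/-- **LEVEL-0 UPPER BOUND** (the input `hUB0` of `ub_tower` for the charged scalar): for contractive phases and unit-modulus transports,
`∀ μ, ∃ f, Q_T f = μ ∧ Sc f ≤ 4d·Σ|μ|²` at block side `n = 1`. [folklore] -/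
theorem ub_level_zero {Rc : Tor (fine 1 M) → Fin d → ℂ} (hR : ∀ y μ, ‖Rc y μ‖ ≤ 1) {T : Tor (fine 1 M) → ℂ} (hT : ∀ x, ‖T x‖ = 1)
    (μ : Tor M → ℂ) : ∃ f, Qk 1 M T f = μ ∧ Sc 1 M Rc f ≤ 4 * d * nsq μ := by
  refine ⟨lift M T μ, Qk_lift M T hT μ, ?_⟩
  have h := sum_dirU_le (fine 1 M) hR (lift M T μ)
  rw [nsq_lift M T hT μ] at h
  unfold Sc
  simpa using h

end Summit.QuantumFields.BalabanUV.T4Continuum.VariationalCovariantLevelZero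

end
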